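import Summits.BirchSwinnertonDyer.Rank1Residual.X2.ResidualDevissageModules
import Literature.NumberTheory.EllipticCurves.BSDSelmerPConverseSerreProofs
import Literature.NumberTheory.EllipticCurves.DivisionFieldRamificationDividesProofs
import Mathlib.Algebra.Module.ZMod
import HarnessLib

/-!
# Crux K1 `CumulativeHeegnerInclusionAtThree` (stmt-BirchSwinnertonDyer-24198), line `birth` — STUB D
# `stub_lineDeterminantAtThree`: the determinant on a Galois-stable line of `E[3]` (Weil pairing)

Lead prover bsd-line-chl-k1-p1 g2 (`--supports stmt-BirchSwinnertonDyer-24198`). For an elliptic curve `E`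
over a number field `K` and a `Γ_K`-stable line `S ≤ E[3]` (order `3`), an element `g ∈ Γ_K` acting on `S`
as the integer `a` and on `E[3]/S` as the integer `d` has mod-`3` cyclotomic character `χ₃(g) = a·d`: in a
frame of `E[3] ≅ 𝔽₃²` adapted to `S` the matrix of `g` is upper triangular with diagonal `(a, d)`, and
`det ρ̄_{E,3} = χ₃` by the Weil pairing (tree `det_eq_modNCyclotomicCharacter`, Silverman in
Cornell–Silverman–Stevens Ch. II §7–8). This is the relation `φψ = ω` of Castella–Grossi–Lee–Skinner §1.3
(display (es-mod)) used to turn the crux's non-anomalous clause `φ|D, ψ|D ≠ 1` into their `θ|D ∉ {1, ω}`.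
Statement = stub D of skeleton v4 of line `birth`, verbatim. THEOREMS ONLY; no definition, no `sorry`.
BSD is not proved by any of this. References: [SilvermanCSS1997] Ch. II §7 Prop., §8; [SilvermanAEC2009]
III.8; [CastellaGrossiLeeSkinner2022] §1.3; [GreenbergVatsal2000] §2 p. 28.
-/

set_option autoImplicit false
-- `…BirchSwinnertonDyer.BirchSwinnertonDyer.Theorems…` is the problem's mandated namespace (D-0017).
set_option linter.dupNamespace false

noncomputable section

open scoped Classical

namespace Summit.BirchSwinnertonDyer.BirchSwinnertonDyer.Theorems.CumulativeHeegnerInclusionAtThreeLineDet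

open NumberField Field WeierstrassCurve
open Literature.NumberTheory.EllipticCurves Literature.NumberTheory.GaloisRepresentations
  Summit.BirchSwinnertonDyer.Rank1Residual.X2.ResidualDevissageModules

/-- **STUB D of line `birth` (skeleton v4), PROVED: the determinant on a stable line of `E[3]`.** For an
elliptic curve `E` over a number field `K`, a `Γ_K`-stable subgroup `S ≤ E[3]` of order `3`, and
`g ∈ Γ_K` acting as the integer `a` on `S` and as `d` on `E[3]/S`: `a·d = χ₃(g)` in `𝔽₃`
(`χ₃ = modNCyclotomicCharacter K 3`). Proof: `E[3] ≅ 𝔽₃²` with first basis vector a generator `P` of `S`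
and second any `Q ∉ S`; `g P = a P`, `g Q = b P + d Q`; the Weil pairing gives `det = χ₃(g)`
(`det_eq_modNCyclotomicCharacter`), and `det (a b; 0 d) = a d`.
[cite: SilvermanCSS1997, Ch. II §7 Proposition and §8 (det ρ̄ = χ)] [cite: CastellaGrossiLeeSkinner2022, §1.3 (φψ = ω)] -/
theorem stub_lineDeterminantAtThree :
    ∀ (K : Type) [Field K] [NumberField K] (E : WeierstrassCurve K) [E.IsElliptic]
      (S : Summit.BirchSwinnertonDyer.Rank1Residual.X2.ResidualDevissageModules.StableSubgroup
        (Field.absoluteGaloisGroup K) (E.geomTorsion ((3 : ℕ) : ℤ))),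
      Nat.card S.Sub = 3 → ∀ (g : Field.absoluteGaloisGroup K) (a d : ℕ),
        (∀ x : S.Sub, g • x = a • x) → (∀ y : S.Quot, g • y = d • y) →
        ((a * d : ℕ) : ZMod 3) =
          ((Literature.NumberTheory.GaloisRepresentations.modNCyclotomicCharacter K 3 g : (ZMod 3)ˣ) : ZMod 3) := by
  intro K _ _ E _ S hS g a d ha hd
  haveI h3 : Fact (Nat.Prime 3) := ⟨Nat.prime_three⟩
  -- the module `M = E[3]`
  set M : Type := ↥(E.geomTorsion ((3 : ℕ) : ℤ)) with hMdef
  have hM3 : ∀ m : M, 3 • m = 0 := fun m ↦ by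
    have h := (Submodule.mem_torsionBy_iff ((3 : ℕ) : ℤ) m.1).mp m.2
    apply Subtype.ext
    rw [AddSubgroupClass.coe_nsmul, ← natCast_zsmul]
    exact h
  letI : Module (ZMod 3) M := AddCommGroup.zmodModule hM3
  have hcardM : Nat.card M = 9 := E.natCard_geomTorsion_prime_eq_sq Nat.prime_three
  -- a generator `P₀` of `S` and its image `P` in `M`
  haveI : Finite S.Sub := Nat.finite_of_card_ne_zero (by rw [hS]; norm_num)
  obtain ⟨P₀, hP₀⟩ : ∃ x : S.Sub, x ≠ 0 := by
    by_contra h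
    push Not at h
    have : Nat.card S.Sub = 1 := Nat.card_eq_one_iff_exists.mpr ⟨0, fun y ↦ h y⟩
    omega
  set P : M := S.incl P₀ with hPdef
  have hP0 : P ≠ 0 := fun h ↦ hP₀ (S.incl_injective (by rw [map_zero]; exact h))
  have hPS : P ∈ S.toAddSubgroup := by rw [hPdef]; exact (P₀ : ↥S.toAddSubgroup).2
  -- every element of `S` is an integer multiple of `P`
  have hgen : ∀ m : M, m ∈ S.toAddSubgroup → ∃ k : ℤ, m = k • P := by
    intro m hm
    have htop : AddSubgroup.zmultiples P₀ = ⊤ := zmultiples_eq_top_of_prime_card hS hP₀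
    have hx : (⟨m, hm⟩ : S.Sub) ∈ AddSubgroup.zmultiples P₀ := by rw [htop]; exact AddSubgroup.mem_top _
    obtain ⟨k, hk⟩ := AddSubgroup.mem_zmultiples_iff.mp hx
    refine ⟨k, ?_⟩
    have h1 : S.incl (k • P₀) = m := by exact congrArg S.incl hk
    calc m = S.incl (k • P₀) := h1.symm
      _ = k • P := by rw [map_zsmul, hPdef]
  -- an element `Q ∉ S`
  obtain ⟨Q, hQ⟩ : ∃ Q : M, Q ∉ S.toAddSubgroup := by
    by_contra h
    push Not at h
    have htop : S.toAddSubgroup = ⊤ := eq_top_iff.mpr fun m _ ↦ h m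
    have h1 : Nat.card S.Sub = Nat.card M := by
      change Nat.card ↥S.toAddSubgroup = _
      rw [htop, AddSubgroup.card_top]
    omega
  -- `ZMod 3`-scalars: a non-zero scalar multiple of a vector outside `S` is outside `S`
  have hsmulS : ∀ (c : ZMod 3) (m : M), m ∈ S.toAddSubgroup → c • m ∈ S.toAddSubgroup :=
    fun c m hm ↦ ZMod.smul_mem hm c
  -- the frame `f : 𝔽₃² → M`, `(x, y) ↦ x P + y Q`
  let f : (Fin 2 → ZMod 3) →+ M :=
    { toFun := fun c ↦ c 0 • P + c 1 • Q
      map_zero' := by simp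
      map_add' := fun c c' ↦ by
        simp only [Pi.add_apply, add_smul]
        abel }
  have hf : ∀ c : Fin 2 → ZMod 3, f c = c 0 • P + c 1 • Q := fun _ ↦ rfl
  have hfinj : Function.Injective f := by
    rw [injective_iff_map_eq_zero]
    intro c hc
    rw [hf] at hc
    -- `c 1 • Q ∈ S`
    have h1 : c 1 • Q ∈ S.toAddSubgroup := by
      have : c 1 • Q = -(c 0 • P) := eq_neg_of_add_eq_zero_right hc
      rw [this]
      exact S.toAddSubgroup.neg_mem (hsmulS _ _ hPS)
    have hc1 : c 1 = 0 := by
      by_contra hne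
      apply hQ
      have : Q = (c 1)⁻¹ • (c 1 • Q) := by rw [smul_smul, inv_mul_cancel₀ hne, one_smul]
      rw [this]
      exact hsmulS _ _ h1
    have hc0 : c 0 = 0 := by
      by_contra hne
      apply hP0
      rw [hc1, zero_smul, add_zero] at hc
      have : P = (c 0)⁻¹ • (c 0 • P) := by rw [smul_smul, inv_mul_cancel₀ hne, one_smul]
      rw [this, hc, smul_zero]
    funext i
    fin_cases i
    · exact hc0
    · exact hc1
  haveI : Finite M := Nat.finite_of_card_ne_zero (by rw [hcardM]; norm_num)
  have hfbij : Function.Bijective f := by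
    refine hfinj.bijective_of_nat_card_le ?_
    simp [hcardM]
  let e : M ≃+ (Fin 2 → ZMod 3) := (AddEquiv.ofBijective f hfbij).symm
  have he : ∀ c, e.symm c = f c := fun _ ↦ rfl
  -- `g P = a P`, `g Q = b P + d Q`
  have hgP : g • P = (a : ZMod 3) • P := by
    rw [Nat.cast_smul_eq_nsmul, hPdef, ← StableSubgroup.incl_smul, ha P₀, map_nsmul]
  obtain ⟨k, hk⟩ : ∃ k : ℤ, g • Q - d • Q = k • P := by
    apply hgen
    rw [← StableSubgroup.ker_proj, AddMonoidHom.mem_ker, map_sub, map_nsmul, ← StableSubgroup.smul_proj,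
      hd, sub_self]
  have hgQ : g • Q = (k : ZMod 3) • P + (d : ZMod 3) • Q := by
    rw [Int.cast_smul_eq_zsmul, Nat.cast_smul_eq_nsmul, ← hk, sub_add_cancel]
  -- the matrix of `g` in the frame `e`
  let Mg : Matrix (Fin 2) (Fin 2) (ZMod 3) := !![(a : ZMod 3), (k : ZMod 3); 0, (d : ZMod 3)]
  have hcomm : ∀ (c : ZMod 3) (m : M), g • (c • m) = c • (g • m) := fun c m ↦
    ZMod.map_smul (DistribSMul.toAddMonoidHom M g) c m
  have hMg : ∀ R : M, e (g • R) = Mg.mulVec (e R) := by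
    intro R
    apply e.symm.injective
    rw [e.symm_apply_apply, he, hf]
    set c := e R with hc
    have hR : R = c 0 • P + c 1 • Q := by rw [← hf, ← he, hc, e.symm_apply_apply]
    have h0 : Mg.mulVec c 0 = (a : ZMod 3) * c 0 + (k : ZMod 3) * c 1 := by
      simp [Mg, Matrix.mulVec, dotProduct, Fin.sum_univ_two]
    have h1 : Mg.mulVec c 1 = (d : ZMod 3) * c 1 := by
      simp [Mg, Matrix.mulVec, dotProduct, Fin.sum_univ_two]
    rw [h0, h1, hR, smul_add, hcomm, hcomm, hgP, hgQ, smul_add, smul_smul, smul_smul, smul_smul, add_smul,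
      mul_comm (c 0) (a : ZMod 3), mul_comm (c 1) (k : ZMod 3), mul_comm (c 1) (d : ZMod 3), add_assoc]
  -- Weil pairing: `det = χ₃(g)`
  haveI : NeZero ((3 : ℕ) : K) := ⟨by exact_mod_cast (by norm_num : (3 : ℕ) ≠ 0)⟩
  have hdet := det_eq_modNCyclotomicCharacter E 3 (by norm_num) e g Mg hMg
  rw [Matrix.det_fin_two_of] at hdet
  rw [Nat.cast_mul, ← hdet]
  ring

end Summit.BirchSwinnertonDyer.BirchSwinnertonDyer.Theorems.CumulativeHeegnerInclusionAtThreeLineDet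

end
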